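import Summits.Ventures.HodgeRepro2.T5SchurIsotypicStep4
import Mathlib.Order.Zorn

/-!
# T5SchurIsotypicSum — (A3) STEP 3 (δ): `L_π` and its closed stable subspaces are orthogonal Hilbert sums of copies of π

Cell pub-hodge-repro2, seat p5, Tier 5 (route/T5-N4-p5.md, N4.3 (A3) STEP 3 (δ), l. 147): «L_π is a
Hilbert sum of copies of π […]: take a maximal family of mutually orthogonal closed subspaces ≅ π
inside L_π (Zorn); if its orthogonal complement L′ inside L_π were non-zero, the orthogonal
projection onto L′ of one of the generating copies W ≅ π of L_π would be a non-zero element of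
R(π, L′) for some W […], and [Bo72] 5.5 would produce a closed subspace of L′ equivalent to π —
contradicting maximality.»

Kernel form (`exists_pairwise_isOrtho_copies_of_le`, and `exists_pairwise_isOrtho_copies` for
`W = L`): for `ρ` unitary on the Hilbert space `E`, `σ` irreducible unitary on a non-trivial `F`,
closed `ρ`-stable subspaces `H i` each unitarily equivalent to `σ`, and a closed `ρ`-stable `W`
inside the closed span `L` of the `H i`, there is a family `S` of pairwise ORTHOGONAL copies of `σ`
(closed, `ρ`-stable, inside `W`, each with an intertwining `F ≃ₗᵢ[ℂ] C`) whose closed span is `W`.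
Proof: Zorn on pairwise-orthogonal families of copies inside `W`; if the closed span `M` of a maximal
family were smaller than `W`, then `W' := W ⊓ Mᗮ ≠ ⊥` is closed, `ρ`-stable and inside `L`, so
`T5SchurIsotypicCopy.exists_copy` (5.5) puts a copy of `σ` inside `W'`, orthogonal to the family —
contradicting maximality.  Both halves of (δ) are therefore obtained without the commutant
`B(ℓ²(I)) ⊗ I` of the printed argument; the prose's «projection of a generating copy» is replaced
by the coordinate projection inside `exists_copy`.

Mathlib only besides the p5 files.  Axioms: propext, Classical.choice, Quot.sound.
-/

namespace Summit.Ventures.HodgeRepro2.T5SchurIsotypicSum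

open ContinuousLinearMap
open scoped InnerProductSpace

variable {E F : Type*} [NormedAddCommGroup E] [InnerProductSpace ℂ E] [CompleteSpace E]
  [NormedAddCommGroup F] [InnerProductSpace ℂ F] [CompleteSpace F]
variable {G : Type*} [Group G]

omit [CompleteSpace E] in
/-- A closed subspace `C'` of a closed subspace `W` of `E`, pushed forward to `E`, is closed. -/
theorem isClosed_map_subtype {W : Submodule ℂ E} (hWc : IsClosed (W : Set E))
    {C' : Submodule ℂ W} (hC'c : IsClosed (C' : Set W)) :
    IsClosed ((C'.map W.subtype : Submodule ℂ E) : Set E) := by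
  rw [Submodule.map_coe, Submodule.coe_subtype]
  exact hWc.isClosedEmbedding_subtypeVal.isClosedMap _ hC'c

/-- If a closed `M ≤ L` is not all of `L`, then `L ⊓ Mᗮ ≠ ⊥`. -/
theorem inf_orthogonal_ne_bot_of_not_le {L M : Submodule ℂ E} (hMc : IsClosed (M : Set E))
    (hML : M ≤ L) (hLM : ¬ L ≤ M) : L ⊓ Mᗮ ≠ ⊥ := by
  haveI : CompleteSpace M := hMc.completeSpace_coe
  intro hbot
  apply hLM
  intro x hx
  have hy : x - M.starProjection x ∈ L ⊓ Mᗮ :=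
    ⟨L.sub_mem hx (hML (M.starProjection_apply_mem x)),
      Submodule.sub_starProjection_mem_orthogonal (K := M) x⟩
  rw [hbot, Submodule.mem_bot, sub_eq_zero] at hy
  rw [hy]
  exact M.starProjection_apply_mem x

/-- **(A3) STEP 3 (δ).**  Every closed `ρ`-stable subspace `W` of the closed span `L` of copies of
the irreducible `σ` is the closed span of a family `S` of pairwise orthogonal copies of `σ` inside
`W` — «L_π is a Hilbert sum of copies of π, and so is every closed G_∞-invariant subspace of L_π». -/
theorem exists_pairwise_isOrtho_copies_of_le [Nontrivial F] {ρ : G →* (E →L[ℂ] E)}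
    (hρ : ∀ g, star (ρ g) = ρ g⁻¹)
    {σ : G →* (F →L[ℂ] F)} (hσ : ∀ g, star (σ g) = σ g⁻¹)
    (hσirr : ∀ V : Submodule ℂ F, IsClosed (V : Set F) →
      (∀ g, ∀ v ∈ V, σ g v ∈ V) → V = ⊥ ∨ V = ⊤)
    {ι : Type*} (H : ι → Submodule ℂ E) (hHc : ∀ i, IsClosed (H i : Set E))
    (hHs : ∀ i g, ∀ x ∈ H i, ρ g x ∈ H i)
    (U : ∀ i, F ≃ₗᵢ[ℂ] H i) (hU : ∀ i g x, ((U i) (σ g x) : E) = ρ g (U i x))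
    {W : Submodule ℂ E} (hWc : IsClosed (W : Set E)) (hWs : ∀ g, ∀ x ∈ W, ρ g x ∈ W)
    (hWle : W ≤ (⨆ i, H i).topologicalClosure) :
    ∃ S : Set (Submodule ℂ E),
      (∀ C ∈ S, IsClosed (C : Set E) ∧ (∀ g, ∀ x ∈ C, ρ g x ∈ C) ∧ C ≤ W ∧
        ∃ V : F ≃ₗᵢ[ℂ] C, ∀ g x, (V (σ g x) : E) = ρ g (V x)) ∧
      S.Pairwise (fun C C' => C ⟂ C') ∧
      (sSup S).topologicalClosure = W := by
  -- the families of pairwise orthogonal copies inside `W`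
  let IsCopy : Submodule ℂ E → Prop := fun C => IsClosed (C : Set E) ∧
    (∀ g, ∀ x ∈ C, ρ g x ∈ C) ∧ C ≤ W ∧ ∃ V : F ≃ₗᵢ[ℂ] C, ∀ g x, (V (σ g x) : E) = ρ g (V x)
  let 𝒮 : Set (Set (Submodule ℂ E)) :=
    {S | (∀ C ∈ S, IsCopy C) ∧ S.Pairwise (fun C C' => C ⟂ C')}
  obtain ⟨S, hSmax⟩ := zorn_subset 𝒮 (fun c hc hchain => by
    refine ⟨⋃₀ c, ⟨?_, ?_⟩, fun s hs => Set.subset_sUnion_of_mem hs⟩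
    · rintro C ⟨s, hs, hCs⟩
      exact (hc hs).1 C hCs
    · rintro C ⟨s, hs, hCs⟩ C' ⟨s', hs', hC's'⟩ hne
      rcases hchain.total hs hs' with h | h
      · exact (hc hs').2 (h hCs) hC's' hne
      · exact (hc hs).2 hCs (h hC's') hne)
  have hS : S ∈ 𝒮 := hSmax.prop
  refine ⟨S, hS.1, hS.2, ?_⟩
  -- the closed span `M` of the maximal family
  set M : Submodule ℂ E := (⨆ C : S, (C : Submodule ℂ E)).topologicalClosure with hM
  have hMc : IsClosed (M : Set E) := Submodule.isClosed_topologicalClosure _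
  have hMs : ∀ g, ∀ x ∈ M, ρ g x ∈ M := fun g =>
    T5SchurIsotypicStep4.stable_topologicalClosure (fun C : S => (hS.1 C C.2).2.1) g
  have hMW : M ≤ W :=
    Submodule.topologicalClosure_minimal _ (iSup_le fun C => (hS.1 C C.2).2.2.1) hWc
  rw [sSup_eq_iSup', ← hM]
  refine le_antisymm hMW ?_
  by_contra hWM
  -- `W' = W ⊓ Mᗮ`, closed, stable, non-zero, inside `L`
  set W' : Submodule ℂ E := W ⊓ Mᗮ with hW'
  have hW'c : IsClosed (W' : Set E) := by
    rw [hW', Submodule.coe_inf]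
    exact hWc.inter M.isClosed_orthogonal
  have hW's : ∀ g, ∀ x ∈ W', ρ g x ∈ W' := fun g x hx =>
    ⟨hWs g x hx.1, T5SchurIff.orthogonal_stable hρ hMs g x hx.2⟩
  have hW'0 : W' ≠ ⊥ := inf_orthogonal_ne_bot_of_not_le hMc hMW hWM
  obtain ⟨ρW', hρW'⟩ := T5SchurIsotypicStep4.exists_restrictRep ρ hW's
  obtain ⟨C', hC'c, hC's, V, hV⟩ := T5SchurIsotypicCopy.exists_copy hρ hσ hσirr H hHc hHs U hU
    hW'c (inf_le_left.trans hWle) hW'0 ρW' hρW'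
  -- the copy pushed forward to `E`
  set C : Submodule ℂ E := C'.map W'.subtype with hC
  have hCW' : C ≤ W' := Submodule.map_subtype_le W' C'
  have hCc : IsClosed (C : Set E) := isClosed_map_subtype hW'c hC'c
  have hCs : ∀ g, ∀ x ∈ C, ρ g x ∈ C := by
    rintro g _ ⟨x, hx, rfl⟩
    exact ⟨ρW' g x, hC's g x hx, hρW' g x⟩
  let e : C' ≃ₗᵢ[ℂ] C :=
    { Submodule.equivMapOfInjective W'.subtype Subtype.val_injective C' with
      norm_map' := fun _ => rfl }
  have hCcopy : IsCopy C := by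
    refine ⟨hCc, hCs, hCW'.trans inf_le_left, V.trans e, fun g x => ?_⟩
    show ((V (σ g x) : W') : E) = ρ g ((V x : W') : E)
    rw [hV, hρW']
  -- `C` is orthogonal to every member of `S`, so `insert C S` is a larger family
  have hCM : C ≤ Mᗮ := hCW'.trans inf_le_right
  have hCS : C ∈ S := by
    refine hSmax.mem_of_prop_insert ⟨?_, ?_⟩
    · intro C₀ hC₀
      rcases hC₀ with rfl | hC₀
      · exact hCcopy
      · exact hS.1 C₀ hC₀
    · rw [Set.pairwise_insert]
      refine ⟨hS.2, fun C₀ hC₀ _ => ?_⟩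
      have hC₀M : C₀ ≤ M :=
        (le_iSup (fun C : S => (C : Submodule ℂ E)) ⟨C₀, hC₀⟩).trans
          (Submodule.le_topologicalClosure _)
      have h1 : C ⟂ C₀ := Submodule.isOrtho_iff_le.mpr (hCM.trans (Submodule.orthogonal_le hC₀M))
      exact ⟨h1, h1.symm⟩
  -- but `C ≤ M` and `C ≤ Mᗮ` force `C = ⊥`, while `C ≅ F` is non-trivial
  have hCbot : C = ⊥ := by
    have hle : C ≤ M ⊓ Mᗮ :=
      le_inf ((le_iSup (fun C : S => (C : Submodule ℂ E)) ⟨C, hCS⟩).trans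
        (Submodule.le_topologicalClosure _)) hCM
    rwa [Submodule.inf_orthogonal_eq_bot, le_bot_iff] at hle
  obtain ⟨x, hx⟩ := exists_ne (0 : F)
  haveI : Subsingleton C := Submodule.subsingleton_iff_eq_bot.mpr hCbot
  exact hx ((V.trans e).injective (Subsingleton.elim _ _))

/-- **(A3) STEP 3 (δ), first half.**  The closed span `L` of copies of the irreducible `σ` is the
closed span of a family of pairwise orthogonal copies of `σ` — «L_π is a Hilbert sum of copies of
π». -/
theorem exists_pairwise_isOrtho_copies [Nontrivial F] {ρ : G →* (E →L[ℂ] E)}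
    (hρ : ∀ g, star (ρ g) = ρ g⁻¹)
    {σ : G →* (F →L[ℂ] F)} (hσ : ∀ g, star (σ g) = σ g⁻¹)
    (hσirr : ∀ V : Submodule ℂ F, IsClosed (V : Set F) →
      (∀ g, ∀ v ∈ V, σ g v ∈ V) → V = ⊥ ∨ V = ⊤)
    {ι : Type*} (H : ι → Submodule ℂ E) (hHc : ∀ i, IsClosed (H i : Set E))
    (hHs : ∀ i g, ∀ x ∈ H i, ρ g x ∈ H i)
    (U : ∀ i, F ≃ₗᵢ[ℂ] H i) (hU : ∀ i g x, ((U i) (σ g x) : E) = ρ g (U i x)) :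
    ∃ S : Set (Submodule ℂ E),
      (∀ C ∈ S, IsClosed (C : Set E) ∧ (∀ g, ∀ x ∈ C, ρ g x ∈ C) ∧
        C ≤ (⨆ i, H i).topologicalClosure ∧
        ∃ V : F ≃ₗᵢ[ℂ] C, ∀ g x, (V (σ g x) : E) = ρ g (V x)) ∧
      S.Pairwise (fun C C' => C ⟂ C') ∧
      (sSup S).topologicalClosure = (⨆ i, H i).topologicalClosure :=
  exists_pairwise_isOrtho_copies_of_le hρ hσ hσirr H hHc hHs U hU
    (Submodule.isClosed_topologicalClosure _)
    (fun g => T5SchurIsotypicStep4.stable_topologicalClosure hHs g) le_rfl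

end Summit.Ventures.HodgeRepro2.T5SchurIsotypicSum
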